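import Mathlib
import Summits.Schanuel.Schanuel.Statement
import Literature.NumberTheory.Transcendental.RoyCriterion
import Literature.NumberTheory.Transcendental.LindemannWeierstrassProofs
import Summits.Schanuel.Schanuel.Theorems.MinimalCounterexampleInAcl.Negative.FirstFailureEcl
import HarnessLib

/-!
# Schanuel's conjecture: the proved rungs (rank `1`, and every rank on the algebraic locus)

`Summits/Schanuel/Schanuel/Theorems/SoloBlindRungs.lean` (soloist `solo-Schanuel-blind`).

The summit `Schanuel = ∀ n, SchanuelRank n` (`Literature.NumberTheory.Transcendental.SchanuelRank`).
This file records, sorry-free and from the tree's *proved* Lindemann–Weierstrass theorem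
(`Literature.NumberTheory.Transcendental.LindemannWeierstrass.AlgIndep_holds`), the part of the
summit that is a theorem today, in the summit's own format:

* `le_trdeg_of_forall_isAlgebraic` — **Lindemann–Weierstrass rung**: `SchanuelRank n` holds for
  every `n` on the locus of tuples `z` with all coordinates algebraic
  (then `e^{z_1}, …, e^{z_n}` are algebraically independent, so `trdeg ℚ(z, e^z) = n`).
* (the **Hermite–Lindemann rung** `SchanuelRank 1` is already in the tree, as
  `MinimalCounterexampleInAcl.Negative.schanuelRank_one'`; it is used below.)
* `one_le_trdeg_of_linearIndependent` — the unconditional bound in every rank `n ≥ 1`: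
  `1 ≤ trdeg ℚ(z, e^z)`.
* `le_trdeg_adjoin_of_algebraicIndependent` — bookkeeping: an algebraically independent family
  inside `ℚ(G)` bounds `trdeg ℚ(G)` from below.

Path to the summit: these are the base cases; the open front is `SchanuelRank 2` (it contains the
algebraic independence of `e` and `π` via `z = (1, iπ)`, of `e` and `e^e` via `z = (1, e)`, and of
`log 2` and `log 3` via `z = (log 2, log 3)`), and by rank descent
(`SoloBlindRankDescent.schanuelRank_anti`) the set of proved ranks is an initial segment of `ℕ`.

References: A. Baker, *Transcendental number theory* (1975), Ch. 1, Thm 1.4 and the remark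
following it (Lindemann–Weierstrass in Weierstrass' form); Ch. Hermite (1873), F. Lindemann (1882).
-/

noncomputable section

open Complex Cardinal IntermediateField

namespace Summit.Schanuel.Schanuel.Theorems

open Literature.NumberTheory.Transcendental (SchanuelRank)
open Literature.NumberTheory.Transcendental.LindemannWeierstrass (AlgIndep_holds)

/-- An algebraically independent family all of whose members lie in `ℚ(G)` bounds the
transcendence degree of `ℚ(G)` from below. [folklore] -/
theorem le_trdeg_adjoin_of_algebraicIndependent {ι : Type} {G : Set ℂ} {w : ι → ℂ}
    (hw : AlgebraicIndependent ℚ w) (hG : ∀ i, w i ∈ IntermediateField.adjoin ℚ G) :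
    #ι ≤ Algebra.trdeg ℚ ↥(IntermediateField.adjoin ℚ G) := by
  set K := IntermediateField.adjoin ℚ G
  let w' : ι → K := fun i => ⟨w i, hG i⟩
  have hw' : AlgebraicIndependent ℚ w' :=
    AlgebraicIndependent.of_comp K.val (by exact hw)
  exact hw'.cardinalMk_le_trdeg

/-- **Lindemann–Weierstrass rung.** Schanuel's conjecture holds, in every rank, for tuples of
algebraic numbers: if `z_1, …, z_n ∈ ℚ̄` are linearly independent over `ℚ` then
`n ≤ trdeg_ℚ ℚ(z, e^z)` (indeed `e^{z_1}, …, e^{z_n}` are algebraically independent).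
[cite: BakerTNT1975, Ch. 1 §3, remark after Theorem 1.4, p. 6] -/
theorem le_trdeg_of_forall_isAlgebraic {n : ℕ} (z : Fin n → ℂ) (halg : ∀ i, IsAlgebraic ℚ (z i))
    (hz : LinearIndependent ℚ z) :
    (n : Cardinal) ≤ Algebra.trdeg ℚ
      ↥(IntermediateField.adjoin ℚ (Set.range z ∪ Set.range (cexp ∘ z))) := by
  have h := AlgIndep_holds n z halg hz
  have := le_trdeg_adjoin_of_algebraicIndependent (G := Set.range z ∪ Set.range (cexp ∘ z)) h
    (fun i => IntermediateField.subset_adjoin ℚ _ (Or.inr ⟨i, rfl⟩))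
  simpa using this

/-- The unconditional bound in every rank `n ≥ 1`: if `z_1, …, z_n` are linearly independent over
`ℚ` then `1 ≤ trdeg_ℚ ℚ(z, e^z)` (Schanuel's conjecture predicts `n`). From the rank-`1` rung
applied to `z_1 ≠ 0`. [folklore] -/
theorem one_le_trdeg_of_linearIndependent {n : ℕ} (hn : 1 ≤ n) (z : Fin n → ℂ)
    (hz : LinearIndependent ℚ z) :
    (1 : Cardinal) ≤ Algebra.trdeg ℚ
      ↥(IntermediateField.adjoin ℚ (Set.range z ∪ Set.range (cexp ∘ z))) := by
  set i₀ : Fin n := ⟨0, hn⟩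
  have hz0 : z i₀ ≠ 0 := hz.ne_zero i₀
  have h1 : LinearIndependent ℚ ![z i₀] :=
    (linearIndependent_unique_iff (R := ℚ) (v := ![z i₀])).2 (by simpa using hz0)
  have hle : IntermediateField.adjoin ℚ (Set.range ![z i₀] ∪ Set.range (cexp ∘ ![z i₀])) ≤
      IntermediateField.adjoin ℚ (Set.range z ∪ Set.range (cexp ∘ z)) := by
    refine IntermediateField.adjoin_le_iff.mpr ?_
    rintro x (⟨j, rfl⟩ | ⟨j, rfl⟩)
    · obtain rfl : j = 0 := Subsingleton.elim _ _
      exact IntermediateField.subset_adjoin ℚ _ (Or.inl ⟨i₀, by simp⟩)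
    · obtain rfl : j = 0 := Subsingleton.elim _ _
      exact IntermediateField.subset_adjoin ℚ _ (Or.inr ⟨i₀, by simp⟩)
  calc (1 : Cardinal) = ((1 : ℕ) : Cardinal) := by norm_num
    _ ≤ Algebra.trdeg ℚ
        ↥(IntermediateField.adjoin ℚ (Set.range ![z i₀] ∪ Set.range (cexp ∘ ![z i₀]))) :=
        MinimalCounterexampleInAcl.Negative.schanuelRank_one' _ h1
    _ ≤ _ := trdeg_le_of_injective (IntermediateField.inclusion hle)
          (IntermediateField.inclusion_injective hle)

end Summit.Schanuel.Schanuel.Theorems
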